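import Summits.ABC.ABC.Theorems.DefiniteXiDefiniteRTControlPrimeOfTakahashiLeaves
import HarnessLib

/-!
# Crux `DefiniteRTControlPrime` from Takahashi 2.3 alone — part 6/7: the re-glue through ONE isogeny to the pivot

`deg_le_of_optimalIsogenyAt` (pointwise core: `deg D ≤ 4 B² · ξ(M;q) · v_q(Δ_min E)` if the Frey curve is joined
to the Takahashi pivot `W⋆` of `exists_conductorMinimal` by one `ℚ`-isogeny of degree `≤ B`), and the consumers
`definiteRTControlPrime_of_optimalRadiusSubpoly`, `definiteRTControlPrime_of_freyIsogenyRadius` (`C = 4R²`),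
`definiteRTControlPrime_of_freyIsogenyRadiusSubpoly`, `definiteRTControlPrime_of_mazurKenkuRadius_oneLeg`
(Takahashi 2.3 + route item `MazurKenkuRadius` alone).  Continues `DefiniteXiDefiniteRTControlPrimeOfTakahashiLeaves`.

Origin: crux programme of stmt-ABC-11338, kernel certificate `Cruxes/DefiniteRTControlPrime/StubIdeasK2G11CruxFromTakahashi.lean` (stub-ideation k2, gens 2–11; farm `lean check` rc 0, 0 sorries, axioms propext/Classical.choice/Quot.sound), re-packaged verbatim into seven `≤ 400`-line modules by k2 gen 12 (namespaces `…Theorems.DefiniteRTControlPrime.CyclicCharacter` / `.OfTakahashi`; statements and proofs unchanged).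

## References

* [Mazur1978] B. Mazur, Rational isogenies of prime degree, Invent. Math. 44 (1978) 129–162, §5 (isogeny characters), Lemma 5.2–5.4.
* [Serre1972] J.-P. Serre, Propriétés galoisiennes des points d'ordre fini des courbes elliptiques, Invent. Math. 15 (1972), §1.11–1.12, §5.4 Prop. 21.
* [SilvermanATAEC1994] J. H. Silverman, Advanced Topics in the Arithmetic of Elliptic Curves, GTM 151, Thm. V.5.3, Cor. V.5.4, Prop. V.6.1 (Tate curve, Galois action).
* [Takahashi2001] S. Takahashi, Degrees of parametrizations of elliptic curves by Shimura curves, J. Number Theory 90 (2001) 74–88, Thm. 2.3 (p. 79).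
* [PastenShimura2024] H. Pasten, Shimura curves and the abc conjecture, J. Number Theory 254 (2024) 214–335 = arXiv:1705.09251, §3 p. 13, §6.4, Lemma 6.8.
-/

set_option linter.dupNamespace false

noncomputable section

namespace Summit.ABC.ABC.Theorems.DefiniteRTControlPrime

open Summit.ABC.ABC.Theses.DefiniteXi
open Summit.ABC.ABC.Theorems.DefiniteRTControlPrime.OfTakahashi
open Literature.NumberTheory.EllipticCurves Literature.NumberTheory.EllipticCurves.ModularForms
open Literature.NumberTheory.Automorphic
open WeierstrassCurve

/-- **G₀ (pointwise core, in `ℕ`; the ONE-ISOGENY PIVOT).**  At one coprime pair, odd conductor prime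
`q` (`N = M q`) and minimal datum `D` of the Frey MODEL: if the Frey curve is joined to the Takahashi
pivot `W⋆` (`exists_conductorMinimal`, p97354) by ONE `ℚ`-isogeny `φ` of degree `≤ B`, then
`deg D ≤ 4 B² · ξ(M; q) · v_q(Δ_min E)`.  Chain: `deg D ≤ 4 deg D₁` (model transport, landed stubs);
`deg D₁ ≤ deg ψ · deg P⋆ = deg φ · deg P⋆` (P1 along `ψ` = dual of `φ` conjugated to the lattice curves);
`deg P⋆ ≤ ξ · v_q(Δ_min W⋆)` (Takahashi); `v_q(Δ_min W⋆) ≤ deg φ · v_q(Δ_min E)` (H2 along `φ`).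
No `W₀`, no `h163`, no `h68`. [cite: Takahashi2001, Thm. 2.3 (p. 79)] [cite: PastenShimura2024, §3 p. 13, §6.4] -/
theorem deg_le_of_optimalIsogenyAt (hT : takahashi2001_thm_2_3_of_coprime) {a b : ℤ}
    (hab : IsCoprime a b) (h0 : a * b * (a + b) ≠ 0) {M q : ℕ} [NeZero (M * q)]
    (hN : (freyCurve a b).conductorNorm ℤ = M * q) (hq : q.Prime) (hq2 : q ≠ 2) {B : ℕ}
    (hOpt : ∀ (W' : WeierstrassCurve ℚ) [W'.IsElliptic]
      (P' : ModularParametrizationData W' (M * q)), W'.conductorNorm ℤ = M * q →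
      (∀ (W'' : WeierstrassCurve ℚ) [W''.IsElliptic], W''.conductorNorm ℤ = M * q →
          ∀ P'' : ModularParametrizationData W'' (M * q), P''.f = P'.f →
            P'.modularDegree ≤ P''.modularDegree) →
      (freyCurve a b).IsIsogenous W' → ∃ φ : Isogeny (freyCurve a b) W', φ.degree ≤ B)
    (D : ModularParametrizationData (freyCurve a b) (M * q))
    (hDmin : ∀ D' : ModularParametrizationData (freyCurve a b) (M * q), D.deg ≤ D'.deg) :
    D.deg ≤ 4 * B * B * (brandtXi M q (fun n => (freyCurve a b).LFunction n) *
      ((freyCurve a b).minimalDiscriminantNorm ℤ).factorization q) := by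
  haveI := isElliptic_freyCurve h0
  have hdiv : M * q / q = M := Nat.mul_div_cancel M hq.pos
  have hqN' : q ∣ (freyCurve a b).conductorNorm ℤ := by rw [hN]; exact Dvd.intro_left M rfl
  -- `gcd(M, q) = 1`
  have hcop : M.Coprime q := by
    have h := stub_freyLocal a b hab h0 q hq hq2 hqN'
    rwa [hN, hdiv] at h
  -- a global minimal model `W_m = C • E`, its data, a minimal one
  obtain ⟨C, hC⟩ := hasGlobalMinimalModel_rat_holds (freyCurve a b)
  haveI := hC
  have hNm : (C • freyCurve a b).conductorNorm ℤ = M * q := by rw [conductorNorm_smul_rat, hN]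
  have hne : Nonempty (ModularParametrizationData (C • freyCurve a b) (M * q)) :=
    (Summit.ABC.ABC.Theorems.nonempty_modularParametrizationData_smul_iff C).mpr ⟨D⟩
  obtain ⟨D₁, -, hD₁min⟩ := exists_minimal_datum hne
  -- the Takahashi pivot `(W⋆, P⋆)` — the ONLY auxiliary curve
  obtain ⟨Ws, hWs, Ps, hNs, hfs, hPsmin⟩ := exists_conductorMinimal D₁ hNm
  haveI := hWs
  -- Takahashi at `(W⋆, P⋆)`
  have hTak : Ps.modularDegree ≤ brandtXi M q (fun n => Ws.LFunction n) *
      (Ws.minimalDiscriminantNorm ℤ).factorization q :=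
    takahashi2001_thm_2_3_of_coprime.modularDegree_le_brandtXi_mul hT Ws M q hq hcop
      hNs Ps hPsmin
  -- `a(W⋆) = a(f₁) = a(W_m) = a(E)`
  have hL : (fun n => Ws.LFunction n) = fun n => (freyCurve a b).LFunction n := by
    funext n
    have h1 := Ps.isNewformOf.2 n
    have h2 := D₁.isNewformOf.2 n
    rw [hfs] at h1
    rw [h1, LFunction_smul] at h2
    exact_mod_cast h2
  rw [hL] at hTak
  -- THE ONE ISOGENY `φ : E → W⋆`, `deg φ ≤ B`
  have hiso : (freyCurve a b).IsIsogenous Ws :=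
    (isIsogenous_smul (freyCurve a b) C).trans' (isIsogenous_of_f_eq D₁ Ps hfs)
  obtain ⟨φ, hφ⟩ := hOpt Ws Ps hNs hPsmin hiso
  -- (T_val) first use of `φ`: H2
  have hval : (Ws.minimalDiscriminantNorm ℤ).factorization q ≤
      B * ((freyCurve a b).minimalDiscriminantNorm ℤ).factorization q :=
    factorization_le_mul_of_isogeny hab h0 hq hq2 hqN' φ hφ
  -- (T_deg) second use of `φ`: its dual, conjugated to the lattice (short) models, through P1
  have hEs : ((⟨1, -Ws.b₂ / 12, -Ws.a₁ / 2, Ws.a₁ * Ws.b₂ / 24 - Ws.a₃ / 2⟩ : VariableChange ℚ)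
      • Ws).baseChange ℂ = Ps.L.curve :=
    shortModel_baseChange_eq_curve Ws Ps.isNeronLattice
  have hEm : ((⟨1, -(C • freyCurve a b).b₂ / 12, -(C • freyCurve a b).a₁ / 2,
      (C • freyCurve a b).a₁ * (C • freyCurve a b).b₂ / 24 - (C • freyCurve a b).a₃ / 2⟩ :
        VariableChange ℚ) • (C • freyCurve a b)).baseChange ℂ = D₁.L.curve :=
    shortModel_baseChange_eq_curve (C • freyCurve a b) D₁.isNeronLattice
  set Cs : VariableChange ℚ := ⟨1, -Ws.b₂ / 12, -Ws.a₁ / 2, Ws.a₁ * Ws.b₂ / 24 - Ws.a₃ / 2⟩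
    with hCs
  set C' : VariableChange ℚ := ⟨1, -(C • freyCurve a b).b₂ / 12, -(C • freyCurve a b).a₁ / 2,
      (C • freyCurve a b).a₁ * (C • freyCurve a b).b₂ / 24 - (C • freyCurve a b).a₃ / 2⟩ with hC'
  obtain ⟨φd, hφd⟩ := exists_dual_degree_eq ((VariableChange.toIsogeny Ws Cs).comp φ)
  obtain ⟨ψ, hψ⟩ : ∃ ψ : Isogeny (Cs • Ws) (C' • (C • freyCurve a b)), ψ.degree = φ.degree :=
    ⟨((VariableChange.toIsogeny (C • freyCurve a b) C').comp
        (VariableChange.toIsogeny (freyCurve a b) C)).comp φd, by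
      rw [degree_comp, degree_comp, hφd, degree_comp, VariableChange.degree_toIsogeny,
        VariableChange.degree_toIsogeny, VariableChange.degree_toIsogeny]
      ring⟩
  have hdeg₁ : D₁.modularDegree ≤ B * Ps.modularDegree := by
    have h := modularDegree_le_degree_mul Ps D₁ hfs.symm hD₁min ψ hEs hEm
    rw [hψ] at h
    exact h.trans (Nat.mul_le_mul_right _ hφ)
  -- (T_model) back to the Frey model
  obtain ⟨D₁', -, hdeg₁'⟩ := stub_smulTransportDeg C D₁
  have hscale : (C.u : ℚ).num.natAbs ≤ 2 := stub_freyScale a b hab h0 C hC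
  have hD : D.deg ≤ 4 * D₁.modularDegree := by
    calc D.deg ≤ D₁'.deg := hDmin D₁'
      _ = (C.u : ℚ).num.natAbs ^ 2 * D₁.deg := hdeg₁'
      _ ≤ 2 ^ 2 * D₁.deg := Nat.mul_le_mul_right _ (Nat.pow_le_pow_left hscale 2)
      _ = 4 * D₁.modularDegree := by norm_num [ModularParametrizationData.modularDegree]
  -- the chain in `ℕ`
  set ξ : ℕ := brandtXi M q (fun n => (freyCurve a b).LFunction n) with hξ
  set v : ℕ := ((freyCurve a b).minimalDiscriminantNorm ℤ).factorization q with hv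
  calc D.deg ≤ 4 * D₁.modularDegree := hD
    _ ≤ 4 * (B * Ps.modularDegree) := Nat.mul_le_mul_left _ hdeg₁
    _ ≤ 4 * (B * (ξ * (Ws.minimalDiscriminantNorm ℤ).factorization q)) :=
        Nat.mul_le_mul_left _ (Nat.mul_le_mul_left _ hTak)
    _ ≤ 4 * (B * (ξ * (B * v))) :=
        Nat.mul_le_mul_left _ (Nat.mul_le_mul_left _ (Nat.mul_le_mul_left _ hval))
    _ = 4 * B * B * (ξ * v) := by ring

/-- **Gε — `DefiniteRTControlPrime` from Takahashi 2.3 and the weakest leaf L0**, `C(ε) = 4 R(ε/2)²`: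
with `B := ⌊R N^(ε/2)⌋₊` in G₀, `deg D ≤ 4 B² ξ v ≤ 4 R² N^ε ξ v` — the crux's `N^ε` is load-bearing. -/
theorem definiteRTControlPrime_of_optimalRadiusSubpoly (hT : takahashi2001_thm_2_3_of_coprime)
    (hRad : FreyOptimalRadiusSubpoly) : DefiniteRTControlPrime := by
  intro ε hε
  obtain ⟨R, hR⟩ := hRad (ε / 2) (half_pos hε)
  refine ⟨4 * (max R 0) ^ 2, ?_⟩
  intro a b hab h0 N _ hN q hq hq2 hqN D hDmin
  have hRN := hR a b hab h0 N hN q hq hq2 hqN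
  -- `N = M q`
  obtain ⟨M, hM⟩ := hqN
  rw [mul_comm] at hM
  subst hM
  have hdiv : M * q / q = M := Nat.mul_div_cancel M hq.pos
  rw [hdiv]
  set Nr : ℝ := ((M * q : ℕ) : ℝ) with hNr
  have hNr0 : (0 : ℝ) ≤ Nr := by positivity
  have hR0 : (0 : ℝ) ≤ max R 0 := le_max_right _ _
  have hpow0 : (0 : ℝ) ≤ Nr ^ (ε / 2) := Real.rpow_nonneg hNr0 _
  -- the integer radius at this `N`
  set B : ℕ := ⌊max R 0 * Nr ^ (ε / 2)⌋₊ with hB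
  have hOptB : ∀ (W' : WeierstrassCurve ℚ) [W'.IsElliptic]
      (P' : ModularParametrizationData W' (M * q)), W'.conductorNorm ℤ = M * q →
      (∀ (W'' : WeierstrassCurve ℚ) [W''.IsElliptic], W''.conductorNorm ℤ = M * q →
          ∀ P'' : ModularParametrizationData W'' (M * q), P''.f = P'.f →
            P'.modularDegree ≤ P''.modularDegree) →
      (freyCurve a b).IsIsogenous W' → ∃ φ : Isogeny (freyCurve a b) W', φ.degree ≤ B := by
    intro W' _ P' hNW' hmin' hiso
    obtain ⟨φ, hφ⟩ := hRN W' P' hNW' hmin' hiso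
    refine ⟨φ, Nat.le_floor ?_⟩
    calc (φ.degree : ℝ) ≤ R * Nr ^ (ε / 2) := hφ
      _ ≤ max R 0 * Nr ^ (ε / 2) := mul_le_mul_of_nonneg_right (le_max_left _ _) hpow0
  have hchain := deg_le_of_optimalIsogenyAt hT hab h0 hN hq hq2 hOptB D hDmin
  set ξ : ℕ := brandtXi M q (fun n => (freyCurve a b).LFunction n) with hξ
  set v : ℕ := ((freyCurve a b).minimalDiscriminantNorm ℤ).factorization q with hv
  have hcast : (D.deg : ℝ) ≤ 4 * (B : ℝ) * (B : ℝ) * ((ξ : ℝ) * (v : ℝ)) := by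
    exact_mod_cast hchain
  have hξv : (0 : ℝ) ≤ (ξ : ℝ) * (v : ℝ) := by positivity
  have hBle : (B : ℝ) ≤ max R 0 * Nr ^ (ε / 2) := Nat.floor_le (mul_nonneg hR0 hpow0)
  have hB0 : (0 : ℝ) ≤ (B : ℝ) := Nat.cast_nonneg _
  have hsq : Nr ^ (ε / 2) * Nr ^ (ε / 2) = Nr ^ ε := by
    rw [← Real.rpow_add' hNr0 (by linarith)]
    ring_nf
  calc (D.deg : ℝ) ≤ 4 * (B : ℝ) * (B : ℝ) * ((ξ : ℝ) * (v : ℝ)) := hcast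
    _ ≤ 4 * (max R 0 * Nr ^ (ε / 2)) * (max R 0 * Nr ^ (ε / 2)) * ((ξ : ℝ) * (v : ℝ)) := by
        gcongr
    _ = 4 * (max R 0) ^ 2 * (Nr ^ (ε / 2) * Nr ^ (ε / 2)) * ((ξ : ℝ) * (v : ℝ)) := by ring
    _ = 4 * (max R 0) ^ 2 * Nr ^ ε * ((ξ : ℝ) * (v : ℝ)) := by rw [hsq]

/-- **G — the crux from Takahashi 2.3 and a ROOTED radius `R`, `C = 4 R²`** (gen-4 rooted glue: `4 R⁴`). -/
theorem definiteRTControlPrime_of_freyIsogenyRadius (hT : takahashi2001_thm_2_3_of_coprime) {R : ℕ}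
    (hR : FreyIsogenyRadius R) : DefiniteRTControlPrime := by
  intro ε hε
  refine ⟨((4 * R * R : ℕ) : ℝ), ?_⟩
  intro a b hab h0 N _ hN q hq hq2 hqN D hDmin
  -- `N = M q`
  obtain ⟨M, hM⟩ := hqN
  rw [mul_comm] at hM
  subst hM
  have hdiv : M * q / q = M := Nat.mul_div_cancel M hq.pos
  rw [hdiv]
  have hqN' : q ∣ (freyCurve a b).conductorNorm ℤ := by rw [hN]; exact Dvd.intro_left M rfl
  have hchain := deg_le_of_optimalIsogenyAt hT hab h0 hN hq hq2
    (fun W' _ P' _ _ hiso => hR a b hab h0 q hq hq2 hqN' W' hiso) D hDmin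
  set ξ : ℕ := brandtXi M q (fun n => (freyCurve a b).LFunction n) with hξ
  set v : ℕ := ((freyCurve a b).minimalDiscriminantNorm ℤ).factorization q with hv
  -- to `ℝ`, inserting the idle `N^ε ≥ 1`
  have hN1 : (1 : ℝ) ≤ ((M * q : ℕ) : ℝ) := by
    exact_mod_cast Nat.one_le_iff_ne_zero.mpr (NeZero.ne (M * q))
  have hrpow : (1 : ℝ) ≤ ((M * q : ℕ) : ℝ) ^ ε := Real.one_le_rpow hN1 hε.le
  have hcast : (D.deg : ℝ) ≤ ((4 * R * R : ℕ) : ℝ) * ((ξ : ℝ) * (v : ℝ)) := by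
    exact_mod_cast hchain
  have hξv : (0 : ℝ) ≤ (ξ : ℝ) * (v : ℝ) := by positivity
  calc (D.deg : ℝ) ≤ ((4 * R * R : ℕ) : ℝ) * ((ξ : ℝ) * (v : ℝ)) := hcast
    _ = ((4 * R * R : ℕ) : ℝ) * 1 * ((ξ : ℝ) * (v : ℝ)) := by ring
    _ ≤ ((4 * R * R : ℕ) : ℝ) * ((M * q : ℕ) : ℝ) ^ ε * ((ξ : ℝ) * (v : ℝ)) := by gcongr

/-- **Gε ∘ (L1ε ⟹ L0).** The crux from Takahashi 2.3 and a sub-polynomial ROOTED radius. -/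
theorem definiteRTControlPrime_of_freyIsogenyRadiusSubpoly (hT : takahashi2001_thm_2_3_of_coprime)
    (hR : FreyIsogenyRadiusSubpoly) : DefiniteRTControlPrime :=
  definiteRTControlPrime_of_optimalRadiusSubpoly hT (freyOptimalRadiusSubpoly_of_rooted hR)

/-- **G ∘ S.** The crux from Takahashi 2.3 and the route item `MazurKenkuRadius` (stmt-ABC-15193) ALONE
(`C = 4·163²`, same constant as p97354 but with neither Pasten fact). -/
theorem definiteRTControlPrime_of_mazurKenkuRadius_oneLeg (hT : takahashi2001_thm_2_3_of_coprime)
    (hR : MazurKenkuRadius) : DefiniteRTControlPrime :=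
  definiteRTControlPrime_of_freyIsogenyRadius hT (freyIsogenyRadius_of_mazurKenkuRadius hR)

end Summit.ABC.ABC.Theorems.DefiniteRTControlPrime

end
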